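import Mathlib
import HarnessLib
import Summits.NavierStokesRegularity.NavierStokesRegularity.Theorems.QuarterLogPincerColdSmoothingKernel
import Summits.NavierStokesRegularity.NavierStokesRegularity.Theorems.QuarterLogPincerEmberCensusHotWitnessFar

/-!
# Route `QuarterLogPincer`, crux `TypeIQuantSubcubicExp` (stmt-NavierStokesRegularity-24077), line `cold_smoothing` —
# the line's PROVED KERNEL by name, part 2: Sa♭ `RegularAftermathM` ⟸ CS1–CS3, and the E2♭ kernel over Sa♭

VERBATIM port (bodies byte-identical up to the unfolding of `E3`) of §R and §5 of `Cruxes/TypeIQuantSubcubicExp/Lines/cold_smoothing.lean` v1.1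
(tree sha16 4ab89edcbc8c8689; idea-crit-4 PASS): `regularAftermathM_of_regularAftermath` (Sa ⇒ Sa♭), `l2_of_frame`, `rpow_neg_succ_mul`,
★ `regularAftermathM_of_stubs : ColdCube → ColdPressureGauge → SmallEnergySmoothing → RegularAftermathM` (Sa♭ ⟸ CS1–CS3: early slab by the
tree's `EmberCensus.norm_iteratedFDeriv_le_of_typeI_far`, late slab by `coldRegularity_of_stubs`), and `terminalEmberM_of_stubsM : RegularAftermathM →
VorticalCentre → EnstrophyPersistence → EmberReadout → TerminalEmberM` (the Sa♭ form of `SilencingCost.terminalEmber_of_stubs`).  NOT ported: the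
sorry-dependent `_via_stubs` products and `terminalEmberM_of_vortical_of_persistence` (see `…ColdSmoothingAssembly` for the by-name products over
the tree).  HONEST FRAME: implications between Props about HYPOTHETICAL Type-I classical solutions; CS1–CS3, Sb, Sc OPEN; nothing here bears on
24077's truth, W7 or Navier–Stokes regularity (OPEN / not proved).  pub-ns-dss typer (g38), `--supports stmt-NavierStokesRegularity-24077`;
bodies by ns-idea-7 (g13).
-/

set_option linter.dupNamespace false

noncomputable section

open MeasureTheory Set Function Filter Topology Metric
open scoped ENNReal NNReal Classical
open Literature.Analysis Literature.Analysis.FluidPDE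
open Summit.NavierStokesRegularity.NavierStokesRegularity.Theorems.ThinCascade
open Summit.NavierStokesRegularity.NavierStokesRegularity.Cruxes.TypeIQuantSubcubicExp.BeadCensus
open Summit.NavierStokesRegularity.NavierStokesRegularity.Cruxes.TypeIQuantSubcubicExp.EmberCensus
  (Hot Terminal HotWitnessNear TerminalEmberM norm_iteratedFDeriv_le_of_typeI_far continuousWithinAt_iteratedFDeriv_slice)
open Summit.NavierStokesRegularity.NavierStokesRegularity.Cruxes.TypeIQuantSubcubicExp.SilencingCost
  (BoxBound boxBound_mono RegularAftermath VorticalCentre EnstrophyPersistence EmberReadout)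

namespace Summit.NavierStokesRegularity.NavierStokesRegularity.Cruxes.TypeIQuantSubcubicExp.ColdSmoothing

/-- Sa ⇒ Sa♭ (weakening of the quantifier prefix). -/
theorem regularAftermathM_of_regularAftermath (h : SilencingCost.RegularAftermath) : RegularAftermathM := by
  intro M hM
  obtain ⟨ε₀, hε₀, H⟩ := h
  refine ⟨ε₀, hε₀, fun ε hε hεle => ?_⟩
  obtain ⟨M₁, hM₁, H'⟩ := H ε M hε hεle hM
  exact ⟨M₁, hM₁, H'⟩

/-- The `L²` clause of the frame (order `0` of the Sobolev clause). -/
theorem l2_of_frame {T : ℝ} {u : ℝ → (EuclideanSpace ℝ (Fin 3)) → (EuclideanSpace ℝ (Fin 3))} {p : ℝ → (EuclideanSpace ℝ (Fin 3)) → ℝ} (hframe : Frame T u p) :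
    ∃ K : NNReal, ∀ t ∈ Icc 0 T, eLpNorm (u t) 2 volume ≤ K := by
  obtain ⟨K, hK⟩ := hframe.2 0
  refine ⟨K, fun t' ht' => ?_⟩
  have e : eLpNorm (u t') 2 volume = eLpNorm (iteratedFDeriv ℝ 0 (u t')) 2 volume :=
    eLpNorm_congr_norm_ae (Eventually.of_forall fun x => (norm_iteratedFDeriv_zero (𝕜 := ℝ)).symm)
  rw [e]; exact hK t' ht'

/-- Power algebra: `(a σ)^{-(j+1)} = a^{-(j+1)} σ^{-(j+1)}` with `a^{-(j+1)} = (1/a)^{j+1}` (nat power). -/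
theorem rpow_neg_succ_mul {a σ : ℝ} (ha : 0 < a) (hσ : 0 < σ) (j : ℕ) :
    (a * σ) ^ (-((j : ℝ) + 1)) = (1 / a) ^ (j + 1) * σ ^ (-((j : ℝ) + 1)) := by
  rw [Real.mul_rpow ha.le hσ.le]
  congr 1
  rw [Real.rpow_neg ha.le, show ((j : ℝ) + 1) = ((j + 1 : ℕ) : ℝ) by push_cast; ring, Real.rpow_natCast,
    one_div, inv_pow]

/-- **Sa♭ from the stubs** (KERNEL).  Early slab (clock at `s` beyond `σ/4`): the rate is the speed `4M/σ` and the
tree's `EmberCensus.norm_iteratedFDeriv_le_of_typeI_far` smooths; late slab (clock `≤ σ/4`): terminality makes the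
backward cylinder `Q_{σ/4}(s,x)` ε-cold (every point of it is later than `t`, within `4Kσ` of `y`, with clock
`≤ σ/2`, and satisfies the room clause), so `coldRegularity_of_stubs` smooths.
`M₁ := (C₀+C₁+C₂+1)(4M)³ + c⋆(4/θ)³`. -/
theorem regularAftermathM_of_stubs (h1 : ColdCube) (h2 : ColdPressureGauge) (h3 : SmallEnergySmoothing) :
    RegularAftermathM := by
  intro M hM
  obtain ⟨ε₁, θ, cs, hε₁, hθ, hθ1, hcs, HR⟩ := coldRegularity_of_stubs h1 h2 h3 M hM
  obtain ⟨C₀, hC₀0, hC₀⟩ := norm_iteratedFDeriv_le_of_typeI_far 0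
  obtain ⟨C₁, hC₁0, hC₁⟩ := norm_iteratedFDeriv_le_of_typeI_far 1
  obtain ⟨C₂, hC₂0, hC₂⟩ := norm_iteratedFDeriv_le_of_typeI_far 2
  have hM0 : 0 < M := by linarith
  set Cs : ℝ := C₀ + C₁ + C₂ with hCs
  have hCs0 : 0 ≤ Cs := by rw [hCs]; positivity
  refine ⟨ε₁, hε₁, fun ε hε hεle => ?_⟩
  set M₁ : ℝ := (Cs + 1) * (4 * M) ^ 3 + cs * (4 / θ) ^ 3 with hM₁
  have h4M : 1 ≤ 4 * M := by linarith
  have h4M3 : 1 ≤ (4 * M) ^ 3 := one_le_pow₀ h4M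
  have h4θ : 1 ≤ 4 / θ := by rw [le_div_iff₀ hθ]; linarith
  have h4θ3 : 1 ≤ (4 / θ) ^ 3 := one_le_pow₀ h4θ
  have hM₁1 : 1 ≤ M₁ := by rw [hM₁]; nlinarith
  refine ⟨M₁, hM₁1, fun K hK => ?_⟩
  intro T τ u p hframe hτ hrate t₁ y t ht₁ htt₁ hhot hterm s hs x hx j hj
  -- the clock `σ` of the hot event
  set σ : ℝ := Real.sqrt (T + τ - t) with hσ
  have hTt : 0 ≤ T + τ - t := by linarith [ht₁.2]
  have hσ2 : σ ^ 2 = T + τ - t := by rw [hσ, Real.sq_sqrt hTt]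
  have hσpos : 0 < σ := by
    have h0 : 0 ≤ σ := Real.sqrt_nonneg _
    rcases h0.lt_or_eq with h | h
    · exact h
    · exfalso; have := hhot.2; rw [← hσ, ← h, zero_mul] at this; linarith
  have hroom : σ ^ 2 ≤ t := by rw [hσ2]; exact hhot.1
  have hsT : s ≤ T := hs.2.trans ht₁.2
  rw [mem_ball, dist_eq_norm] at hx
  have hσpow : ∀ j : ℕ, 0 < σ ^ (-((j : ℝ) + 1)) := fun j => Real.rpow_pos_of_pos hσpos _
  by_cases hfar : (σ / 4) ^ 2 < T + τ - s
  · -- EARLY SLAB: the rate is the speed `4M/σ`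
    have hL2 := l2_of_frame hframe
    have hr0 : 0 < σ / 4 := by positivity
    have hwin : s ∈ Ioc ((σ / 4) ^ 2 / M ^ 2) s := by
      refine ⟨?_, le_rfl⟩
      have hM2 : 1 ≤ M ^ 2 := one_le_pow₀ hM
      have h1 : (σ / 4) ^ 2 / M ^ 2 ≤ (σ / 4) ^ 2 := by
        rw [div_le_iff₀ (by positivity)]
        have := mul_le_mul_of_nonneg_left hM2 (sq_nonneg (σ / 4))
        linarith
      have hq : (σ / 4) ^ 2 = σ ^ 2 / 16 := by ring
      have hσσ : 0 < σ ^ 2 := by positivity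
      linarith [hs.1]
    have hD : ‖iteratedFDeriv ℝ j (u s) x‖ ≤ Cs * (M / (σ / 4)) ^ (j + 1) := by
      have hGp : 0 ≤ (M / (σ / 4)) ^ (j + 1) := pow_nonneg (div_nonneg hM0.le hr0.le) _
      interval_cases j
      · exact (hC₀ hframe.1 hL2 hτ hM0 hr0 hrate hsT hfar s hwin x).trans
          (mul_le_mul_of_nonneg_right (by rw [hCs]; linarith) hGp)
      · exact (hC₁ hframe.1 hL2 hτ hM0 hr0 hrate hsT hfar s hwin x).trans
          (mul_le_mul_of_nonneg_right (by rw [hCs]; linarith) hGp)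
      · exact (hC₂ hframe.1 hL2 hτ hM0 hr0 hrate hsT hfar s hwin x).trans
          (mul_le_mul_of_nonneg_right (by rw [hCs]; linarith) hGp)
    refine hD.trans ?_
    have e1 : (M / (σ / 4)) ^ (j + 1) = (4 * M) ^ (j + 1) * σ ^ (-((j : ℝ) + 1)) := by
      rw [Real.rpow_neg hσpos.le, show ((j : ℝ) + 1) = ((j + 1 : ℕ) : ℝ) by push_cast; ring,
        Real.rpow_natCast, show M / (σ / 4) = (4 * M) * σ⁻¹ by field_simp, mul_pow, inv_pow]
    rw [e1, ← mul_assoc]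
    refine mul_le_mul_of_nonneg_right ?_ (hσpow j).le
    have hj3 : (4 * M) ^ (j + 1) ≤ (4 * M) ^ 3 := pow_le_pow_right₀ h4M (by omega)
    have hpos2 : 0 ≤ cs * (4 / θ) ^ 3 := by positivity
    have hpow0 : 0 ≤ (4 * M) ^ 3 := by positivity
    calc Cs * (4 * M) ^ (j + 1) ≤ Cs * (4 * M) ^ 3 := mul_le_mul_of_nonneg_left hj3 hCs0
      _ ≤ (Cs + 1) * (4 * M) ^ 3 := by nlinarith
      _ ≤ M₁ := by rw [hM₁]; linarith
  · -- LATE SLAB: terminality makes `Q_{σ/4}(s,x)` ε-cold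
    have hnear : T + τ - s ≤ (σ / 4) ^ 2 := le_of_not_gt hfar
    have hρ : 0 < σ / 4 := by positivity
    have hρs : (σ / 4) ^ 2 ≤ (s, x).1 := by show (σ / 4) ^ 2 ≤ s; nlinarith [hs.1]
    have hcold : ColdOn ε (T + τ) u (parabolicCylinder (σ / 4) (s, x)) := by
      intro w hw
      rw [parabolicCylinder, mem_prod, mem_Ioo, mem_ball, dist_eq_norm] at hw
      obtain ⟨⟨hw1, hw2⟩, hw3⟩ := hw
      by_contra hhot'
      push Not at hhot'
      have hw3' : ‖w.2 - x‖ < σ / 4 := hw3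
      have hq : (σ / 4) ^ 2 = σ ^ 2 / 16 := by ring
      have hσσ : 0 < σ ^ 2 := by positivity
      refine hterm w.2 w.1 ?_ ?_ ?_ ?_ ⟨?_, hhot'⟩
      · show t < w.1
        linarith
      · show w.1 ≤ t₁
        linarith [hs.2]
      · show 4 * (T + τ - w.1) ≤ T + τ - t
        linarith
      · show ‖w.2 - y‖ ≤ 4 * K * Real.sqrt (T + τ - t)
        rw [← hσ]
        have : ‖w.2 - y‖ ≤ ‖w.2 - x‖ + ‖x - y‖ := by
          calc ‖w.2 - y‖ = ‖(w.2 - x) + (x - y)‖ := by congr 1; abel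
            _ ≤ ‖w.2 - x‖ + ‖x - y‖ := norm_add_le _ _
        have hKσ : σ / 4 ≤ 2 * K * σ := by nlinarith
        linarith
      · show T + τ - w.1 ≤ w.1
        linarith
    have hsq0 : 0 ≤ (θ * (σ / 4) / 2) ^ 2 := sq_nonneg _
    have hmem : s ∈ Icc (s - (θ * (σ / 4) / 2) ^ 2) s := ⟨by linarith, le_rfl⟩
    have hballx : x ∈ ball x (θ * (σ / 4) / 2) := mem_ball_self (by positivity)
    have hreg := HR T τ u p hframe hτ hrate ε (s, x) (σ / 4) hε.le hεle hρ hρs hsT hcold s hmem x hballx j hj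
    refine hreg.trans ?_
    have e1 : (θ * (σ / 4)) ^ (-((j : ℝ) + 1)) = (1 / (θ / 4)) ^ (j + 1) * σ ^ (-((j : ℝ) + 1)) := by
      rw [show θ * (σ / 4) = (θ / 4) * σ by ring]
      exact rpow_neg_succ_mul (by positivity) hσpos j
    rw [e1, ← mul_assoc]
    refine mul_le_mul_of_nonneg_right ?_ (hσpow j).le
    have e2 : (1 / (θ / 4)) = 4 / θ := by field_simp
    rw [e2]
    have hj3 : (4 / θ) ^ (j + 1) ≤ (4 / θ) ^ 3 := pow_le_pow_right₀ h4θ (by omega)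
    have hpos1 : 0 ≤ (Cs + 1) * (4 * M) ^ 3 := by positivity
    calc cs * (4 / θ) ^ (j + 1) ≤ cs * (4 / θ) ^ 3 := mul_le_mul_of_nonneg_left hj3 (by linarith)
      _ ≤ M₁ := by rw [hM₁]; linarith

/-- **S.K♭ KERNEL** — `silencing_cost`'s `terminalEmber_of_stubs` (tree `…SilencingCostKernel`, body verbatim after the
first four lines) re-run with Sa♭ `RegularAftermathM` in place of Sa: `RegularAftermathM → VorticalCentre →
EnstrophyPersistence → EmberReadout → TerminalEmberM`. -/
theorem terminalEmberM_of_stubsM (hA : RegularAftermathM) (hB : SilencingCost.VorticalCentre)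
    (hC : SilencingCost.EnstrophyPersistence) (hD : SilencingCost.EmberReadout) : TerminalEmberM := by
  intro M hM
  obtain ⟨ε₁, hε₁, hA⟩ := hA M hM
  refine ⟨ε₁, hε₁, fun ε hε hεle => ?_⟩
  obtain ⟨M₁, hM₁, hA⟩ := hA ε hε hεle
  obtain ⟨C₀, hI⟩ :=
    Summit.NavierStokesRegularity.NavierStokesRegularity.Cruxes.TypeIQuantSubcubicExp.ThinCascade.stub_uniformScaledEnergy
      M
  obtain ⟨Γ₂, δ, hΓ₂, hδ, hB⟩ := hB ε M₁ C₀ hε hM₁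
  obtain ⟨K, c, hK, hc, hC⟩ := hC M₁ δ Γ₂ hM₁ hδ hΓ₂
  have hK1 : 1 ≤ K := le_trans hΓ₂ hK
  obtain ⟨c', hc', hD⟩ := hD K M₁ c hK1 hM₁ hc
  refine ⟨2 * K, c', Γ₂ ^ 2, by linarith, hc', by nlinarith, ?_⟩
  intro T τ u p hframe hτ htypeI t₁ y t ht₁ htt₁ hroom hhot hterm
  -- positivity of the clock and of the hot time
  have hTt : 0 < T + τ - t := by linarith [ht₁.2]
  have ht0 : 0 < t := by have h := hhot.1; linarith
  have htT : t ≤ T := le_trans htt₁ ht₁.2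
  have htI : t ∈ Icc 0 T := ⟨ht0.le, htT⟩
  have ht₁I : t₁ ∈ Icc 0 T := ⟨ht₁.1.le, ht₁.2⟩
  have hσpos : 0 < Real.sqrt (T + τ - t) := Real.sqrt_pos.2 hTt
  have hσsq : Real.sqrt (T + τ - t) ^ 2 = T + τ - t := Real.sq_sqrt hTt.le
  have hhot2 : ε < Real.sqrt (T + τ - t) * ‖u t y‖ := hhot.2
  -- (a) the regular box of aperture `2K` (Sa♭)
  have hbox4 := hA (2 * K) (by linarith) T τ u p hframe hτ htypeI t₁ y t ht₁ htt₁ hhot hterm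
  generalize hσdef : Real.sqrt (T + τ - t) = σ at hσpos hσsq hhot2 hbox4 ⊢
  have hKσ : 0 < K * σ := mul_pos (by linarith) hσpos
  have hbox : SilencingCost.BoxBound M₁ σ u y (Icc t t₁) (2 * K * σ) := SilencingCost.boxBound_mono hbox4 (by nlinarith)
  -- (b) I1 on the frame restricted to `[0,t]` gives the slice energy at radius `Γ₂σ`, then Sb
  have hframe_t := frame_restrict hframe ht0 htT
  have hτ' : 0 < T - t + τ := by linarith
  have hrate_t := typeI_restrict htypeI htT
  have hΓσ : 0 < Γ₂ * σ := mul_pos (by linarith) hσpos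
  have hΓσ2 : (Γ₂ * σ) ^ 2 ≤ t := by
    have e : (Γ₂ * σ) ^ 2 = Γ₂ ^ 2 * (T + τ - t) := by rw [mul_pow, hσsq]
    rw [e]; exact hroom
  have hI1 := (hI t (T - t + τ) u p hframe_t hτ' hrate_t y (Γ₂ * σ) hΓσ hΓσ2).1 t
    ⟨by nlinarith [sq_nonneg (Γ₂ * σ)], le_rfl⟩
  have hv2 : ContDiff ℝ 2 (u t) := (hframe.1.contDiff_velocity htI).of_le (WithTop.coe_le_coe.2 le_top)
  have hgrad : ∀ x ∈ ball y σ, ∀ j : ℕ, j ≤ 2 →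
      ‖iteratedFDeriv ℝ j (u t) x‖ ≤ M₁ * σ ^ (-((j : ℝ) + 1)) :=
    fun x hx j hj => hbox t ⟨le_rfl, htt₁⟩ x (ball_subset_ball (by nlinarith) hx) j hj
  have hvort := hB (u t) y σ hσpos hv2 (hframe.1.divFree t htI) hgrad hI1 hhot2
  -- (c) the linear lemma from `t` to `t₁`
  have hspan : t₁ ≤ t + σ ^ 2 := by rw [hσsq]; linarith [ht₁.2]
  have hpers := hC T u p hframe.1 y σ t t₁ hσpos ht0.le htt₁ ht₁.2 hspan hbox hvort
  -- (d) readout at `t₁`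
  have hv2' : ContDiff ℝ 2 (u t₁) :=
    (hframe.1.contDiff_velocity ht₁I).of_le (WithTop.coe_le_coe.2 le_top)
  exact hD (u t₁) y σ hσpos hv2' (fun x hx j hj => hbox t₁ ⟨htt₁, le_rfl⟩ x hx j hj) hpers

end Summit.NavierStokesRegularity.NavierStokesRegularity.Cruxes.TypeIQuantSubcubicExp.ColdSmoothing

end
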